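import Summits.CriticalPhenomena.SAWScalingLimit.Theorems.SAWDevelopingMapNoFoldBoundLoopWinding
import Summits.CriticalPhenomena.SAWScalingLimit.Theorems.SAWDevelopingMapNoFoldBoundWalledClasses

/-!
# The rigid winding classes of first arrivals at a vertex adjacent to the source vertex

Helper file for the crux `NoFoldBound` (stmt-CriticalPhenomena-8296) of the route
`SAWDevelopingMap` (sub-problem `SAWScalingLimit` of `CriticalPhenomena`), line `Ideator3Sketch`,
stub `stub_sourceAdjClasses` (the hypothesis `hC` of `sourceAdj_core`, SourceAdjPort).

Setting (Duminil-Copin–Smirnov 2012, §2): a finite vertex set `Λ` of the hexagonal lattice `ℍ`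
with connected complement (`hexDomainSimplyConnected`), the source mid-edge `a = {x, w}` with
`x ∉ Λ ∋ w` (`w` the SOURCE VERTEX), the two other neighbours `v, y` of `w` (`v ∈ Λ`, `v ∉ a`),
and a FIRST ARRIVAL at `v` through a port `p ≠ w`: a self-avoiding walk `γ` from `a` to the
mid-edge `{v, p}` avoiding `v`.  Such a walk starts `w → y` (its first vertex is the endpoint `w`
of `a` in `Λ`, its second vertex is a neighbour of `w` in `Λ` other than `v`, i.e. `y`) and ends
at `p`.  We prove the RIGID winding formula

  `W(γ) = −5·W(mid a → c w → mid{w,y}) − W(mid{p,v} → c v → mid{v,w}) − W(mid{v,w} → c w → mid{w,y})`.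

## Proof

The template is `stub_loopWinding` (LoopWinding).  Code everything in the coordinate model `HV`
by the chart `Φ` at the dart `x → w` (`HV.exists_chart`).  The winding of `γ` is `(π/3) · pturn`
of its code `Φ x, Φ(γ), Φ v` (`HexMidEdgeSAW.winding_eq_pturn_code`), and each one-step winding
`mid{s,t} → c t → mid{t,r}` is `(π/3) · turn (Φ s) (Φ t) (Φ r)` (`winding_midpoints_eq_turn`).
The closed-up walk `Φ w, Φ y, …, Φ p, Φ v` is a simple cycle of `Φ(Λ)` (`v ∉ γ`, `p ∼ v ∼ w`);
the outer vertex `x ∉ Λ` is off the cycle and joined off `Λ` to infinity (connected complement),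
so the faces at `Φ x` have winding number `0` (`wnd_rightFace_eq_zero_of_simplyConnected`) and
the loop lemma `HV.cturn_eq_neg_six_mul_turn` gives the turning number
`cturn = −6 τ`, `τ = turn (Φ x) (Φ w) (Φ y)`.  On the other hand
`cturn = pturn (Φ w, …, Φ p, Φ v) + turn (Φ p) (Φ v) (Φ w) + turn (Φ v) (Φ w) (Φ y)` (the two
closing turns at `v` and at `w`) and `pturn (code) = τ + pturn (Φ w, …, Φ p, Φ v)`, whence
`pturn (code) = −5 τ − turn (Φ p) (Φ v) (Φ w) − turn (Φ v) (Φ w) (Φ y)`.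
-/

noncomputable section

open Literature.Probability.LatticeModels Literature.Probability.RandomPlanarGeometry.SAW

namespace Summit.CriticalPhenomena.SAWScalingLimit.Theorems.SAWDevelopingMapNoFoldBound

open Literature.Probability.RandomPlanarGeometry.SAW.HV
open Summit.CriticalPhenomena.SAWScalingLimit.Theorems.SourceLoopBound

variable {Λ : Finset HexVertex} {a : Sym2 HexVertex} {v p : HexVertex}

/-! ### Closing up a first arrival through the arrival vertex -/

/-- Closing up a first arrival `γ : a → {v, p}` (avoiding `v`, `v ∈ Λ`) by the vertex `v`: the
vertices of `γ.verts ++ [v]` lie in `Λ`. -/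
theorem arrival_concat_subset (hv : v ∈ Λ) (γ : HexMidEdgeSAW Λ a s(v, p)) :
    ∀ t ∈ γ.verts ++ [v], t ∈ Λ := by
  intro t ht
  rcases List.mem_append.1 ht with ht | ht
  · exact γ.subset t ht
  · rw [List.mem_singleton.1 ht]; exact hv

/-- Closing up a first arrival by the (unvisited) arrival vertex keeps the vertex list
duplicate-free. -/
theorem arrival_concat_nodup (γ : HexMidEdgeSAW Λ a s(v, p)) (hvγ : v ∉ γ.verts) :
    (γ.verts ++ [v]).Nodup :=
  List.nodup_append.2 ⟨γ.nodup, List.nodup_singleton v,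
    fun x hx y hy hxy => hvγ (by rw [List.mem_singleton.1 hy] at hxy; exact hxy ▸ hx)⟩

/-- Closing up a first arrival at `v` through `p` (it ends at `p ∼ v`) by the vertex `v` keeps
consecutive vertices adjacent. -/
theorem arrival_concat_isChain (hva : v ∉ a) (hvp : hexGraph.Adj v p)
    (γ : HexMidEdgeSAW Λ a s(v, p)) (hvγ : v ∉ γ.verts) :
    (γ.verts ++ [v]).IsChain hexGraph.Adj := by
  have hlast := arrival_getLast?_eq hva γ hvγ
  refine List.IsChain.append γ.isChain (List.isChain_singleton v) fun x hx y hy => ?_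
  rw [Option.mem_def, hlast, Option.some.injEq] at hx
  rw [Option.mem_def, List.head?_cons, Option.some.injEq] at hy
  rw [← hx, ← hy]; exact hvp.symm

/-! ### The rigid classes -/

/-- **Stub (source-adjacent classes).** Let `Λ` be simply connected with source
`a = {x, w} ∈ ∂Ω` (`x ∉ Λ`, `w ∈ Λ` the source vertex, third neighbour `y` of `w`), `v ∈ Λ` off
`a` a neighbour of `w`. Every first arrival `γ` at `v` through a port `p ≠ w` (a walk
`w → y → ⋯ → p` avoiding `v`) has the RIGID winding
`W(γ) = −5·W(mid a → c w → mid{w,y}) − W(mid{p,v} → c v → mid{v,w}) − W(mid{v,w} → c w → mid{w,y})`: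
the closed-up cycle `w → y → ⋯ → p → v → w` is simple, lies in `Λ`, and is seen from `x ∉ Λ`
(attached to infinity off `Λ` by simple connectivity), so the loop lemma
`HV.cturn_eq_neg_six_mul_turn` gives its turning number `−6·turn(x, w, y)`; subtract the turns at
`v` and `w` and add the initial turn `x → w → y` of `γ`. (Duminil-Copin–Smirnov 2012, proof of
Lemma 1: "we used the fact that `a` is on the boundary and `Ω` is simply connected".) -/
theorem stub_sourceAdjClasses :
    ∀ (Λ : Finset HexVertex), hexDomainSimplyConnected Λ → ∀ a ∈ hexDomainBoundary Λ,
      ∀ (v w x y p : HexVertex), v ∈ Λ → v ∉ a → w ∈ Λ → a = s(x, w) → hexGraph.Adj w v →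
      hexGraph.Adj w x → hexGraph.Adj w y → v ≠ x → x ≠ y → v ≠ y → x ∉ Λ →
      hexGraph.Adj v p → p ≠ w → ∀ (γ : HexMidEdgeSAW Λ a s(v, p)), v ∉ γ.verts →
        γ.winding = -5 * winding [hexMidpoint s(x, w), hexCenter w, hexMidpoint s(w, y)] -
          winding [hexMidpoint s(p, v), hexCenter v, hexMidpoint s(v, w)] -
          winding [hexMidpoint s(v, w), hexCenter w, hexMidpoint s(w, y)] := by
  intro Λ hΛ a _ v w x y p hv hva _ hax hwv hwx hwy hvx hxy hvy hx hvp hpw γ hvγ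
  classical
  -- the chart at the dart `x → w` of the source mid-edge
  obtain ⟨Φ, α, β, hα, hΦx, hΦw, haff⟩ := exists_chart hwx.symm
  -- adjacencies in the model
  have awx : hvGraph.Adj (Φ w) (Φ x) := (Φ.map_rel_iff).2 hwx
  have awv : hvGraph.Adj (Φ w) (Φ v) := (Φ.map_rel_iff).2 hwv
  -- the walk: nonempty, starts `w, y`, ends at `p`
  have hne : γ.verts ≠ [] := arrival_verts_ne_nil hva γ
  have hlast : γ.verts.getLast hne = p := by
    rcases γ.getLast_eq_or hne with h | h
    · have hm : γ.verts.getLast hne ∈ γ.verts := List.getLast_mem hne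
      rw [h] at hm
      exact absurd hm hvγ
    · exact h
  obtain ⟨rest, hrest⟩ : ∃ rest, γ.verts = w :: y :: rest := by
    have hhead : γ.verts.head hne = w := γ.head_eq hax hx hne
    obtain ⟨w', tail, hwt⟩ := List.exists_cons_of_ne_nil hne
    have hw' : w' = w := by simpa [hwt] using hhead
    subst hw'
    -- the walk has a second vertex (its last vertex is `p ≠ w'`)
    obtain ⟨z, rest, hzt⟩ : ∃ z rest, tail = z :: rest := by
      rcases tail with _ | ⟨z, rest⟩
      · exfalso
        have : γ.verts.getLast hne = w' := by simp [hwt]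
        exact hpw (hlast.symm.trans this)
      · exact ⟨z, rest, rfl⟩
    subst hzt
    -- the second vertex is a neighbour of `w'` in `Λ` other than `v`, i.e. `y`
    have hch := γ.isChain
    rw [hwt] at hch
    have hwz : hexGraph.Adj w' z := (List.isChain_cons_cons.1 hch).1
    have hzΛ : z ∈ Λ := γ.subset z (by simp [hwt])
    have hzγ : z ∈ γ.verts := by simp [hwt]
    rcases eq_or_eq_or_eq_of_adj hwv hwx hwy hvx hvy hxy hwz with h | h | h
    · exact absurd (h ▸ hzγ) hvγ
    · exact absurd (h ▸ hzΛ) hx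
    · exact ⟨rest, by rw [hwt, h]⟩
  -- Step 1: the winding of `γ` is `(π/3) · pturn` of its code `Φ x, Φ(γ), Φ v`
  have hW := γ.winding_eq_pturn_code hax hx hΦx hΦw hvp haff hα hne (e := v)
    (Or.inr ⟨hlast, rfl⟩)
  set R : List HV := rest.map Φ with hR
  have hcodeM : γ.verts.map Φ = Φ w :: Φ y :: R := by
    rw [hrest, List.map_cons, List.map_cons]
  have hcode : (γ.verts ++ [v]).map Φ = Φ w :: Φ y :: (R ++ [Φ v]) := by
    rw [List.map_append, hcodeM]; rfl
  rw [hcodeM, ← hΦx] at hW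
  -- Step 2: the closed-up walk `Φ w :: Φ y :: (R ++ [Φ v])` is a simple cycle of `Φ(Λ)`
  have hmem : ∀ z ∈ Φ w :: Φ y :: (R ++ [Φ v]), ∃ t ∈ γ.verts ++ [v], Φ t = z := fun z hz => by
    rw [← hcode, List.mem_map] at hz
    exact hz
  have hCl : (Φ w :: Φ y :: (R ++ [Φ v])).getLast (List.cons_ne_nil _ _) = Φ v := by
    simp
  have hMl : (Φ w :: Φ y :: R).getLast (List.cons_ne_nil _ _) = Φ p := by
    have h1 : (γ.verts.map Φ).getLast (by simpa using hne) = Φ p := by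
      rw [List.getLast_map, hlast]
    simpa only [hcodeM] using h1
  have hcyc : IsCyc (Φ w :: Φ y :: (R ++ [Φ v])) := by
    refine ⟨?_, ?_, fun d hd => ?_⟩
    · simp only [List.length_cons, List.length_append]
      omega
    · rw [← hcode]
      exact (arrival_concat_nodup γ hvγ).map Φ.injective
    · rw [cdarts_eq (List.cons_ne_nil _ _), List.mem_append, List.mem_singleton] at hd
      rcases hd with hd | rfl
      · have hch : ((γ.verts ++ [v]).map Φ).IsChain hvGraph.Adj := by
          rw [List.isChain_map]
          exact List.IsChain.imp (fun p q h => (Φ.map_rel_iff).2 h)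
            (arrival_concat_isChain hva hvp γ hvγ)
        rw [hcode] at hch
        exact adj_of_mem_pdarts hch d hd
      · rw [hCl, List.head_cons]
        exact awv.symm
  have hxn : Φ x ∉ Φ w :: Φ y :: (R ++ [Φ v]) := fun h => by
    obtain ⟨t, ht, htx⟩ := hmem _ h
    have htx' : t = x := Φ.injective htx
    subst htx'
    rcases List.mem_append.1 ht with h' | h'
    · exact hx (γ.subset _ h')
    · exact hvx (List.mem_singleton.1 h').symm
  -- Step 3: `x` is outside the cycle (connected complement), so the loop lemma applies
  have h0 : wnd (Φ w :: Φ y :: (R ++ [Φ v])) (leftFace (Φ w) (Φ x)) = 0 :=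
    wnd_rightFace_eq_zero_of_simplyConnected hΛ hx Φ
      (fun z hz => by
        obtain ⟨t, ht, rfl⟩ := hmem z hz
        exact ⟨t, arrival_concat_subset hv γ t ht, rfl⟩)
      hcyc.2.2 awx.symm
  have key := cturn_eq_neg_six_mul_turn hcyc (List.cons_ne_nil _ _) awx hxn h0
  simp only [List.head_cons] at key
  -- Step 4: book-keeping — the turning number is the turning of the open code plus the two
  -- closing turns at `v` and at `w`
  have e6 : cturn (Φ w :: Φ y :: (R ++ [Φ v])) =
      pturn (Φ w :: Φ y :: (R ++ [Φ v]) ++ [Φ w]) + turn (Φ v) (Φ w) (Φ y) := by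
    rw [cturn, show (Φ w :: Φ y :: (R ++ [Φ v])).take 2 = [Φ w, Φ y] from rfl,
      pturn_concat_turn (Φ w :: Φ y :: (R ++ [Φ v])) (List.cons_ne_nil _ _) (Φ w) (Φ y), hCl]
  have e7 : pturn (Φ w :: Φ y :: (R ++ [Φ v]) ++ [Φ w]) =
      pturn (Φ w :: Φ y :: (R ++ [Φ v])) + turn (Φ p) (Φ v) (Φ w) := by
    have e : Φ w :: Φ y :: (R ++ [Φ v]) ++ [Φ w] = (Φ w :: Φ y :: R) ++ [Φ v, Φ w] := by simp
    rw [e, pturn_concat_turn (Φ w :: Φ y :: R) (List.cons_ne_nil _ _) (Φ v) (Φ w), hMl]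
    simp
  have hZ : pturn (Φ w :: Φ y :: (R ++ [Φ v])) =
      -6 * turn (Φ x) (Φ w) (Φ y) - turn (Φ p) (Φ v) (Φ w) - turn (Φ v) (Φ w) (Φ y) := by
    linarith
  -- Step 5: the one-step windings are `(π/3) · turn`
  have hτ₁ := winding_midpoints_eq_turn (Φ := Φ) hwx hwy hxy haff hα
  have hτ₂ := winding_midpoints_eq_turn (Φ := Φ) hvp hwv.symm hpw haff hα
  have hτ₃ := winding_midpoints_eq_turn (Φ := Φ) hwv hwy hvy haff hα
  simp only [List.cons_append] at hW
  rw [hW, pturn_cons₃, hZ, hτ₁, hτ₂, hτ₃]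
  push_cast
  ring

end Summit.CriticalPhenomena.SAWScalingLimit.Theorems.SAWDevelopingMapNoFoldBound
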